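import Summits.NavierStokesRegularity.FluidComputer.PalasekTowerGermHostCompanionFar
import Summits.NavierStokesRegularity.FluidComputer.PalasekTowerGermHostStrictTiny

/-!
# The germ host, XXII: HOST PREPARATION FOR EVERY AMPLIFIER — the named strict carrier carries any
# far structure into the registered slot

Cell `ns-blowup`, seat `ns-blowup-ecbridge-3` (g4); GROUP C «BRIDGE SUPPORT» of the route
`PalasekTowerBreakdown` (crux `EpisodeBaseG`, item stmt-NavierStokesRegularity-19179, R2 of record;
registered line `slot`: ONE stub `∃ U ρ c₄ (h : Germ.LevelZeroData U ρ) …, PushedLevelWitness (h.schedule c₄ …)`).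
Capstone of XIX–XX (`PalasekTowerGermHostCompanion`, `…CompanionFar`) on the kernel filler of XIII
(`levelZeroData_named : LevelZeroData (strictTinyProfile strictTinyScale) 7`, p457442). LABEL: E–C typing
(KERNEL bookkeeping, no definition). WHAT THIS IS NOT: not Navier–Stokes evidence — the level-`0` host of
a PRESCRIBED composite profile; nothing about any flow after `τ₀`, `FirstEpisodeD`, `RungG 1` or blow-up.

## What and why

The lineage `host_preparation` of this seat, in its final form: **for EVERY candidate amplifier `W`**
(smooth, divergence free, `tsupport W ⊆ B̄(0, R)`, everywhere slower than `Y₀` — a ring pair, a dipole,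
a colliding-jet configuration, whatever a mechanism card names) the design

  `U(W, c) := strictTinyProfile a⋆ + W(· − c)`   (the tiny strict readout carrier at the origin, the
  amplifier translated to `c`)

fills the STRICT slot as soon as `‖c‖ ≥ 8 + R + max(1/N₀, 1 + 3Y₀∫‖W‖²/(2π·rate⋆))`, `rate⋆` the
carrier's rising rate (GermHost V) — `levelZeroData_strictTiny_add_translate` — hence (GermHost III)
its germ schedule is a pinned, rigid, quiet, PREPARED host in its singleton class for every push
`c₄ ∈ (0, 1]` (`hostPreparationD_amplifier`), and the crux for that design is its episode
(`episodeBaseG_of_firstEpisodeD_amplifier`). Host preparation is thereby discharged for every design a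
mechanism seat can propose, uniformly, with ONE number to check about `W` (its speed bound); what the
crux still asks is the EPISODE of `W` — untouched here.

References: S. Palasek, arXiv:2605.13827 §3.3 (host preparation before the first readout)
[cite: Palasek2026ElementaryModel, §3.3]; D. Gilbarg, N. S. Trudinger, *Elliptic PDE of Second Order*
(2001), Lemma 4.1 [cite: GilbargTrudinger2001, Lemma 4.1].
-/

noncomputable section

namespace Summit.NavierStokesRegularity.FluidComputer.PalasekTowerClayBridge.Germ

open Set Function Filter Topology InnerProductSpace Metric MeasureTheory Real
open scoped Topology ContDiff RealInnerProductSpace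

open Literature.Analysis.FluidPDE

variable {W : EuclideanSpace ℝ (Fin 3) → EuclideanSpace ℝ (Fin 3)} {R : ℝ} {c : EuclideanSpace ℝ (Fin 3)}
  (hW : ContDiff ℝ ∞ W) (hdivW : VectorCalculus.IsDivFree W) (hWsupp : tsupport W ⊆ closedBall 0 R)
  (hWlt : ∀ x, ‖W x‖ < TowerRates.wide.Y 0) (hR : 0 ≤ R)
  (hc : 8 + R + max (1 / TowerRates.wide.N 0)
      (1 + 3 * TowerRates.wide.Y 0 * (∫ x, ‖W x‖ ^ 2) / (2 * π * levelZeroData_named.rate)) ≤ ‖c‖)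

include hW hdivW hWsupp hWlt hR hc

/-- **THE NAMED STRICT CARRIER CARRIES EVERY AMPLIFIER FAR ENOUGH**: for every smooth divergence-free
`W` with `tsupport W ⊆ B̄(0, R)` (`R ≥ 0`) and speed `< Y₀`, and every centre `c` with
`‖c‖ ≥ 8 + R + max(1/N₀, 1 + 3Y₀∫‖W‖²/(2π·rate⋆))`, the composite `strictTinyProfile a⋆ + W(· − c)` fills
the STRICT slot `LevelZeroData · (‖c‖ + R)` — an admissible `U` of the registered stub.
[cite: GilbargTrudinger2001, Lemma 4.1] -/
theorem levelZeroData_strictTiny_add_translate :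
    LevelZeroData (strictTinyProfile strictTinyScale + fun x => W (x - c)) (‖c‖ + R) := by
  have hE0 : 0 ≤ ∫ x, ‖W x‖ ^ 2 := integral_nonneg fun x => by positivity
  have hle := le_max_left (1 / TowerRates.wide.N 0)
    (1 + 3 * TowerRates.wide.Y 0 * (∫ x, ‖W x‖ ^ 2) / (2 * π * levelZeroData_named.rate))
  exact levelZeroData_named.add_translate hW hdivW hWsupp hWlt hR hle (by linarith)
    (fun _ hx => levelZeroData_named.rate_le hx)
    (budget_lt_of_le hE0 levelZeroData_named.rate_pos le_rfl)

/-- **HOST PREPARATION FOR EVERY AMPLIFIER**: the germ schedule of `strictTinyProfile a⋆ + W(· − c)` is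
prepared in its singleton class, for every push constant `c₄ ∈ (0, 1]`. [cite: Palasek2026ElementaryModel, §3.3] -/
theorem hostPreparationD_amplifier {c₄ : ℝ} (hc₄ : 0 < c₄) (hc₄' : c₄ ≤ 1) :
    HostPreparationD (HostClass.exact
      ((levelZeroData_strictTiny_add_translate hW hdivW hWsupp hWlt hR hc).schedule c₄ hc₄ hc₄')) :=
  (levelZeroData_strictTiny_add_translate hW hdivW hWsupp hWlt hR hc).hostPreparationD_exact hc₄ hc₄'

/-- **… and the crux for that design is its episode**: `FirstEpisodeD` over the singleton class of the
germ schedule of `strictTinyProfile a⋆ + W(· − c)` gives `EpisodeBaseG`. [cite: Palasek2026ElementaryModel, §4] -/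
theorem episodeBaseG_of_firstEpisodeD_amplifier {c₄ : ℝ} (hc₄ : 0 < c₄) (hc₄' : c₄ ≤ 1)
    (hF : FirstEpisodeD (HostClass.exact
      ((levelZeroData_strictTiny_add_translate hW hdivW hWsupp hWlt hR hc).schedule c₄ hc₄ hc₄'))) :
    EpisodeBaseG :=
  (levelZeroData_strictTiny_add_translate hW hdivW hWsupp hWlt hR hc).episodeBaseG_of_firstEpisodeD
    hc₄ hc₄' hF

end Summit.NavierStokesRegularity.FluidComputer.PalasekTowerClayBridge.Germ

end
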